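import Summits.ResolutionOfSingularities.ResolutionOfSingularities.Theorems.FrobeniusClosingSteerBetaXLetterLawCore
import HarnessLib

/-!
# Crux `Steer` (stmt-ResolutionOfSingularities-16345), chain W4.1, β-LEAF, K-β2♭ part (III-X): the GLUE `xLetterLawHat_of` —
# dispatch on the chart point over the core at the origin (def-free)

OURS (campaign `res-hironaka`, rung L ★L-G4, slot W4.1; statements about the route's own objects; they replace the
role of no printed item and are NOT statements of the manuscript under review [claim: Hironaka2017, status:
under-review]; AI review is weaker than expert review). Seat res-D-pv-003 (gen 7), K-β2♭ owner; GLUE (III) per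
res-L0-w41-plan-1 RULING 276(a); the β-leaf's designed sorry `xLetterLawHat_of` (v18.4-J4 and successors).

`xLetterLawHat_of_words (hatt) (hface) (hV) (hII) (hShear) (hYesc) (hIrr) : XLetterLawHat` (tree words p553853): an IRRATIONAL chart
point is the residual binder `XLetterLawIrrEscHat`; a RATIONAL `c ≠ 0` out of a twist with a `y`-part is the residual binder
`XLetterLawYEscHat`; a rational `c ≠ 0` with `y`-free twist is SHEARED to the origin (`ShearLetterHat`: the stage datum, `v*` and `δ*` move
to the frame `(x, y + x·σ c₀, z, w)`, whose `x`-chart presentation at `0` is read off the given one in characteristic `2`); the origin is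
the core `xLetterLaw_origin` (`…BetaXLetterLawCore`).

[cite: CossartJannsenSaito2020, Lemma 12.1 and 13.6] No Theses file is imported; nothing here is a route item or a registration.
-/

noncomputable section

-- `Summit.<S>.<S>.…` duplicates the summit name by design (single-problem summit).
set_option linter.dupNamespace false

namespace Summit.ResolutionOfSingularities.ResolutionOfSingularities.Theorems.SwitchingDichotomy.BetaHat

open IsLocalRing
open Literature.AlgebraicGeometry.Resolution
open Summit.ResolutionOfSingularities.ResolutionOfSingularities.Theorems.SwitchingDichotomy.BetaPolygon
open Summit.ResolutionOfSingularities.ResolutionOfSingularities.Theorems.SwitchingDichotomy.BetaNewton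

/-- **GLUE (III-X): the star-level `x`-law `XLetterLawHat` from the attainment words, the vertex theorem, the preparedness transfer
`PreparedTransferXHat`, the shear `ShearLetterHat` and the two residual binders.** [cite: CossartJannsenSaito2020, Lemma 12.1] -/
theorem xLetterLawHat_of_words (hatt : PrepAttainHat) (hface : FacePrepAttainHat) (hV : VertexTheoremTwHat)
    (hII : PreparedTransferXHat) (hShear : ShearLetterHat) (hYesc : XLetterLawYEscHat) (hIrr : XLetterLawIrrEscHat) :
    XLetterLawHat := by
  intro S S₁ _ _ _ _ _ _ φ σ σ₁ x y z w u f c v₁ z₁ w₁ u₁ f₁ d k α β δ α₁ β₁ hS hS₁ hodd h3 hA hX hrad hA₁ hVf hδ hV₁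
  classical
  by_cases hrat : ∃ c₀ : ResidueField S, residue S₁ (φ (σ c₀)) = c
  · obtain ⟨c₀, hc₀⟩ := hrat
    by_cases hc : c = 0
    · subst hc
      exact xLetterLaw_origin hatt hface hV hII S S₁ φ σ σ₁ x y z w u f v₁ z₁ w₁ u₁ f₁ d k α β δ α₁ β₁ hS hS₁ hodd h3
        hA hX hrad hA₁ hVf hδ hV₁
    · by_cases hyfree : ∃ a : ℕ, u = x ^ a
      · -- shear to the origin
        have hS' := hS; have hA' := hA
        obtain ⟨-, hreg, -, hdim, -⟩ := hS'
        obtain ⟨hspan, ⟨a, b, ha, hb, hu⟩, -⟩ := hA'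
        obtain ⟨hσ, hσ₁, hcompat, hpoly, hspan₁, hy, hz, hw⟩ := hX
        haveI := hreg
        have ht : IsRsopPart ![x, y, z, w] := isRsopPart_four hreg hdim hspan
        haveI : IsDomain S := isDomain_of_isRegularLocalRing S
        have hab : ∃ a : ℕ, a ≤ 1 ∧ u = x ^ a := by
          obtain ⟨a', ha'⟩ := hyfree
          rcases Nat.eq_zero_or_pos b with hb0 | hb0
          · exact ⟨a, ha, by rw [hu, hb0, pow_zero, mul_one]⟩
          · exfalso
            have hpy : Prime y := by simpa using ht.prime 1
            have hyx : ¬ y ∣ x := by simpa using ht.not_dvd (i := 1) (j := 0) (by decide)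
            have hdvd : y ∣ x ^ a' := ⟨x ^ a * y ^ (b - 1), by
              obtain ⟨b', rfl⟩ := Nat.exists_eq_add_of_le hb0
              rw [← ha', hu, Nat.add_sub_cancel_left, pow_add, pow_one]; ring⟩
            exact hyx (hpy.dvd_of_dvd_pow hdvd)
        obtain ⟨hAsh, hVsh, hδsh⟩ := hShear S x y z w u f (σ c₀) d hA hab
        have h2 : (2 : S₁) = 0 := by simpa using CharP.cast_eq_zero S₁ 2
        have hysh : φ (y + x * σ c₀) = φ x * (σ₁ 0 + v₁) := by
          rw [map_add, map_mul, hy, hcompat c₀, hc₀, map_zero, zero_add]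
          linear_combination (φ x * σ₁ c) * h2
        have hpoly0 : ∀ b' : ResidueField S₁, ∃ P : Polynomial (ResidueField S),
            b' = P.eval₂ ((residue S₁).comp (φ.comp σ)) 0 := by
          intro b'
          obtain ⟨P, hP⟩ := hpoly b'
          refine ⟨Polynomial.C (P.eval c₀), ?_⟩
          rw [Polynomial.eval₂_C, hP, ← hc₀]
          exact Polynomial.eval₂_at_apply ((residue S₁).comp (φ.comp σ)) c₀
        have hXsh : IsXChartHat φ σ σ₁ x (y + x * σ c₀) z w 0 v₁ z₁ w₁ := ⟨hσ, hσ₁, hcompat, hpoly0, hspan₁, hysh, hz, hw⟩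
        exact xLetterLaw_origin hatt hface hV hII S S₁ φ σ σ₁ x (y + x * σ c₀) z w u f v₁ z₁ w₁ u₁ f₁ d k α β δ α₁ β₁
          hS hS₁ hodd h3 hAsh hXsh hrad hA₁ (hVsh α β hVf) (hδsh δ hδ) hV₁
      · exact hYesc S S₁ φ σ σ₁ x y z w u f c v₁ z₁ w₁ u₁ f₁ d k α β δ α₁ β₁ hS hS₁ hodd h3 hA hX hc ⟨c₀, hc₀⟩ hyfree
          hrad hA₁ hVf hδ hV₁
  · push Not at hrat
    exact hIrr S S₁ φ σ σ₁ x y z w u f c v₁ z₁ w₁ u₁ f₁ d k α β δ α₁ β₁ hS hS₁ hodd h3 hA hX hrat hrad hA₁ hVf hδ hV₁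

end Summit.ResolutionOfSingularities.ResolutionOfSingularities.Theorems.SwitchingDichotomy.BetaHat

end
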